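import Summits.QuantumFields.YangMills.Theorems.BalabanUVNodesN15SmallFieldUnitLayerLive
import Summits.QuantumFields.YangMills.Theorems.BalabanUVNodesN15SmallFieldSiteLayerLiveKnit
import HarnessLib

/-!
# N15 = NE2 — Σ-col (L-5): ★★★ THE ALL-LIVE KNIT — `Live ∧ N15At` for dag-n15-c's live small-field family with OPERATOR, SITE AND UNIT LAYERS ALL READING THE NON-ABELIAN POTENTIAL
# (on the large-cube sub-family; FLAG №13's located burden «non-abelian G(U) dressing of NE2» typed in all three layers for road (c))
# (dag-n15-a g29, programme Σ-col, FILE (L-5); node N15 = NE2; `--supports stmt-QuantumFields-27366 --as helper`, count-neutral; 2 plumbing defs `sfObjects₄covAll`, `wAll` + theorems)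

WHAT.  §1 generic restriction of the three conjuncts along an index map (`ne2PlusOperator_comp`, `ne2PlusSite_comp`); ★★ `live_sfGE` (the large-cube sub-family passes dag-n15-w2's guard for ANY
kernels — jointly cofinal, zero potential regular); ★ `foCovSf_one_eq_covOnS` (CONSISTENCY: at `U ≡ 1` the U-live unit kernel of (L-4) IS (J-d)'s U-blind kernel of record `covOnS` times `δ_{jj′}`).  §2 ★★★ **`live_and_n15At_sf₄cov_allLive`**: `d ≥ 1`, odd `L ≥ 7`, `a, c₃₅ > 0`, trace-form-orthonormal `e`, `ι` nonempty, directions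
`μ₁ μ₂` (operator entries), `α β j j′` (site), `α′ β′ j₂ j₂′` (unit), any `p` ⟹ `∃ w, Live ∧ N15At ⟨SfIdxGE d L w, c₃₅, p, sfInstance∘val, sfFamily … (sfE₄cov …)∘val, foSiteSf …∘val,
foCovSf …∘val, ⊤, dist⟩` — OPERATOR = Σ-F `ne2PlusOperator_sf₄cov` (n15-c FILE 145, all four (3.42) entries), SITE = (J-c) `ne2PlusSite_foSiteSf`, UNIT = (L-4) `ne2PlusUnit_foCovSf`: NO U-blind
layer is left on this family.  §3 the road-(c) LITERAL `sfObjects₄covAll … w` (`NE2Objects₁₁`) + `rfl` + `exists_live_and_n15At_sfObjects₄covAll`, the pinned threshold `wAll` (a choice) with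
★★★ `live_and_n15At_sfObjects₄covAll_wAll` (CLOSED literal, guard ∧ `N15At`), keyed face `s_N15_of_admits_sf₄covAll` (part 30's interface) — a drop-in for a road-(c) re-pin with no U-blind layer.

HONEST FRAMING ∕ LIMITS.  By-name composition over landed rows + (J-c)∕(L-4); MODEL objects exactly as n15-c FILE 130∕133∕145 and (L-1)…(L-4) (global small-field gauge; covariant Laplacian ⊗
colour + FLAT nonlocal part (1.69), not (3.26); King-block-mean pairing; doubled torus; `L ≥ 7`; large cubes `L^m ≥ w`) — NOT [B9] Thms 3.1∕3.2∕3.15 AS PRINTED.  N15 stays DISCHARGED OF RECORD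
AS CONSUMED (U-blind v7 pin, p687738) — no re-pin asked (road (b)∕(c) re-pins are the PLAN's), nothing re-claimed, no count moved (typed 28∕28 · discharged 8∕28); K3⁸ OPEN; one finite 𝕋⁴ at
fixed ε per index — NOT ℝ⁴ ∕ infinite volume ∕ OS ∕ mass gap ∕ Clay.  No `sorry`, `instance`, `notation`, `maxHeartbeats`; standard axioms.
[cite: Balaban1985BackgroundPropagators, Thm 3.1 (3.42) p.397, Thm 3.2 (3.48) p.398 + (3.132) p.422, Thm 3.15 (3.187) p.432 (quantifier templates)]
-/

noncomputable section

open scoped BigOperators Matrix Matrix.Norms.Frobenius Kronecker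

namespace Summit.QuantumFields.YangMills.BalabanUVNodes.N15.SiteLayerSf

open Literature.MathematicalPhysics.QuantumFieldTheory.Balaban1983to89
open Literature.MathematicalPhysics.QuantumFieldTheory.Balaban1983to89.T4EtaRate (PairedInstance NE2PlusOperator NE2PlusSite NE2PlusUnit)
open Literature.Barriers.QuantumFields (traceForm)
open Summit.QuantumFields.YangMills.BalabanUVNodes.N15.OperatorReadout (opGeo)
open Summit.QuantumFields.YangMills.BalabanUVNodes.N15.MatrixSpecies (liftBlk)
open Summit.QuantumFields.YangMills.BalabanUVNodes.N15.Gluing (SfIdx sfInstance sfInstance_reg335_iff sfFamily CvX CvX' cvM cvBlk)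
open Literature.MathematicalPhysics.QuantumFieldTheory.Balaban1983to89.B5Prop11Plancherel (Tor)
open Literature.MathematicalPhysics.QuantumFieldTheory.Balaban1983to89.T4EtaRateUnitWitness (covDiff)
open Summit.QuantumFields.YangMills.BalabanUVNodes.N15.GenuineRecord (sfTG live_opGeoS sfE₄cov ne2PlusOperator_sf₄cov covOnS covOnS_ker tgCovStep_ker)
open Summit.QuantumFields.YangMills.BalabanUVNodes.N15.PairedFamilyGuard (Live)
open Literature.MathematicalPhysics.QuantumFieldTheory.Balaban1983to89.T4Continuum (T4Family ULoop)
open Node00 (NE2Objects₁₁)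
open Summit.QuantumFields.YangMills.BalabanUVNodes.N15.AtKeyedHome (s_N15_of_admits)
open YMDAG.UVSplit (Datum RateCarriers RateRecordPred N15At S_N15 ne2OfRecord₁₁)

variable (d : ℕ) {L : ℕ} [NeZero L] (mm ι : Type) [Fintype mm] [DecidableEq mm] [Fintype ι] [DecidableEq ι] (a : ℝ) (e : Matrix mm mm ℂ ≃L[ℝ] (ι → ℝ))

/-! ## §1 Restriction along an index map; the guard on the large-cube sub-family -/

section Restrict

/-- `NE2PlusOperator` restricts along any index map. [bookkeeping] -/
theorem ne2PlusOperator_comp {I J : Type} (f : J → I) {c35 : ℝ} {pi : I → PairedInstance} {Kd : ∀ i, B9.KernelFamily (pi i).gc (pi i).Bf}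
    (h : NE2PlusOperator c35 pi Kd) : NE2PlusOperator c35 (fun j => pi (f j)) (fun j => Kd (f j)) := by
  obtain ⟨M₅, δ₀, a₀, B₀, γ, h1, h2, h3, h4, h5, H⟩ := h
  exact ⟨M₅, δ₀, a₀, B₀, γ, h1, h2, h3, h4, h5, fun j => H (f j)⟩

/-- `NE2PlusSite` restricts along any index map. [bookkeeping] -/
theorem ne2PlusSite_comp {I J : Type} (f : J → I) {d' : ℕ} {p c35 : ℝ} {pi : I → PairedInstance} {Kd : ∀ i, B9.SiteKernel (pi i).gc (pi i).Bf}
    (h : NE2PlusSite d' p c35 pi Kd) : NE2PlusSite d' p c35 (fun j => pi (f j)) (fun j => Kd (f j)) := by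
  obtain ⟨M₅, δ, a₀, C, γ, h1, h2, h3, h4, h5, H⟩ := h
  exact ⟨M₅, δ, a₀, C, γ, h1, h2, h3, h4, h5, fun j => H (f j)⟩

omit [DecidableEq ι] in
/-- ★★ **THE LARGE-CUBE SUB-FAMILY PASSES THE K3⁷∕K3⁸ GUARD, FOR ANY KERNELS** (S-D `live_opGeoS`): `(L^m, kk)` jointly cofinal on `SfIdxGE d L w` (take `m` with `L^m ≥ max(M₅, w)`), and the
zero potential is (3.35)∕(3.36)-regular at every `α₀ > 0` (`c₃₅ ≥ 0`). [bookkeeping] -/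
theorem live_sfGE (hL : Odd L ∧ 1 < L) (w : ℝ) {c35 : ℝ} (hc35 : 0 ≤ c35) (p : ℝ)
    (Kop : ∀ i : SfIdxGE d L w, B9.KernelFamily (sfInstance d mm ι hL i.1).gc (sfInstance d mm ι hL i.1).Bf)
    (Ksite Kunit : ∀ i : SfIdxGE d L w, B9.SiteKernel (sfInstance d mm ι hL i.1).gc (sfInstance d mm ι hL i.1).Bf) :
    Live ⟨SfIdxGE d L w, c35, p, fun i => sfInstance d mm ι hL i.1, Kop, Ksite, Kunit, fun _ _ => True, fun i => (sfInstance d mm ι hL i.1).gc.dist⟩ := by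
  refine live_opGeoS (d := d) hL (fun i : SfIdxGE d L w => sfTG d i.1) (fun i => (L : ℝ) ^ i.1.m) (fun i => CvX d L i.1.m i.1.kk hL × ι)
    (fun i => liftBlk (cvBlk d L i.1.m i.1.kk hL) ι) (fun i => (sfInstance d mm ι hL i.1).gf) (fun i => (sfInstance d mm ι hL i.1).Bc) (fun i => (sfInstance d mm ι hL i.1).Bf)
    (fun i => (sfInstance d mm ι hL i.1).pair) c35 p Kop Ksite Kunit (fun M₅ k₀ => ?_) (fun i α₀ hα₀ => ?_)
  · obtain ⟨m, hm⟩ := pow_unbounded_of_one_lt (max M₅ w) (by exact_mod_cast hL.2 : (1 : ℝ) < (L : ℝ))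
    have hw : w ≤ ((L ^ m : ℕ) : ℝ) := by push_cast; exact (le_max_right _ _).trans hm.le
    exact ⟨⟨⟨m, max k₀ 1, 0, le_max_right _ _⟩, hw⟩, (le_max_left _ _).trans hm.le, le_max_left _ _⟩
  · have h0 : (0 : ℝ) ≤ c35 * (L : ℝ) ^ i.1.m * α₀ := by positivity
    have h1 : (sfInstance d mm ι hL i.1).Bf.one = (0 : Fin (d + 1) → CvX' d L i.1.m i.1.kk i.1.r hL → Matrix mm mm ℂ) := rfl
    have hreg : (sfInstance d mm ι hL i.1).Bf.Reg335 c35 α₀ (sfInstance d mm ι hL i.1).Bf.one := by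
      rw [h1]
      refine (sfInstance_reg335_iff d mm ι hL i.1 c35 α₀ _).2 ⟨fun μ x' => ?_, fun μ x' => ?_, fun μ κ x' => ?_, fun μ κ x' => ?_⟩
      · simp only [Pi.zero_apply, Matrix.conjTranspose_zero, neg_zero]
      · simp only [Pi.zero_apply, norm_zero]; exact h0
      · simp only [Pi.zero_apply, sub_self, norm_zero]; positivity
      · simp only [Pi.zero_apply, sub_self, norm_zero]; positivity
    exact ⟨hreg, hreg⟩

/-- ★ **CONSISTENCY WITH THE UNIT KERNEL OF RECORD — AT THE ZERO POTENTIAL THE U-LIVE UNIT KERNEL IS S-D's (2.156) RE-BASED KERNEL `covOnS` TIMES `δ_{jj′}`** (`d ≥ 1`, `L ≥ 7` odd,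
`a > 0`, indices with `L^m ≥ w₀`, trace-form-orthonormal `e`): (L-4) `foCovSf_one` + S-D `covOnS_ker` + part 76 `tgCovStep_ker`∕`covDiff` (`L^{k+r} = L^rL^k`).  So on `SfIdx` the unit
layer of (J-d) (U-blind, `covOnS`) and the unit layer of THIS file (U-live, `foCovSf`) carry the SAME object at `U ≡ 1`, colour-diagonally. [cite: Balaban1984PropagatorsII, (2.156) p.250] -/
theorem foCovSf_one_eq_covOnS (hd : 1 ≤ d) (hL : Odd L ∧ 1 < L) (hL7 : 7 ≤ L) (ha : 0 < a) (α β : Fin (d + 1)) (j j' : ι) :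
    ∃ w₀ : ℝ, ∀ (i : SfIdx d L), w₀ ≤ ((L ^ i.m : ℕ) : ℝ) → (∀ A B : Matrix mm mm ℂ, traceForm A B = e A ⬝ᵥ e B) → ∀ (y y' : Tor (cvM d L i.m i.kk hL)),
      (foCovSf d mm ι a e hL α β j j' i).ker (sfInstance d mm ι hL i).Bf.one y y' =
        if j = j' then
          (covOnS d hL α β (sfTG d) (fun i => (L : ℝ) ^ i.m) (fun i => CvX d L i.m i.kk hL × ι) (fun i => liftBlk (cvBlk d L i.m i.kk hL) ι) (fun i => (sfInstance d mm ι hL i).Bf) i).ker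
            (sfInstance d mm ι hL i).Bf.one y y'
        else 0 := by
  obtain ⟨w₀, H⟩ := foCovSf_one d mm ι a e hd hL hL7 ha α β j j'
  refine ⟨w₀, fun i hw he y y' => ?_⟩
  rw [H i hw he y y', covOnS_ker, tgCovStep_ker, covDiff, pow_add, mul_comm (L ^ (sfTG d i).k)]
  rfl

end Restrict

/-! ## §2 ★★★ The all-live knit -/

section Knit

/-- ★★★ **`Live ∧ N15At` FOR dag-n15-c's LIVE SMALL-FIELD FAMILY WITH ALL THREE LAYERS READING `A′`** (large-cube sub-family `SfIdxGE d L w`): `d ≥ 1`, odd `L ≥ 7`, `a, c₃₅ > 0`,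
trace-form-orthonormal `e`, `ι` nonempty; directions `μ₁ μ₂` (operator entries 1–2), `α β` + colours `j j′` (site bonds), `α′ β′` + colours `j₂ j₂′` (unit bonds), any `p`:
OPERATOR = Σ-F `ne2PlusOperator_sf₄cov` (restricted), SITE = (J-c) `ne2PlusSite_foSiteSf` (restricted), UNIT = (L-4) `ne2PlusUnit_foCovSf`, GUARD = `live_sfGE`. [bookkeeping] -/
theorem live_and_n15At_sf₄cov_allLive [Nonempty ι] (hd : 1 ≤ d) (hL : Odd L ∧ 1 < L) (hL7 : 7 ≤ L) (ha : 0 < a) {c35 : ℝ} (hc35 : 0 < c35)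
    (he : ∀ A B : Matrix mm mm ℂ, traceForm A B = e A ⬝ᵥ e B) (μ₁ μ₂ α β : Fin (d + 1)) (j j' : ι) (α' β' : Fin (d + 1)) (j₂ j₂' : ι) (p : ℝ) :
    ∃ w : ℝ,
      Live ⟨SfIdxGE d L w, c35, p, fun i => sfInstance d mm ι hL i.1, fun i => sfFamily d mm ι a e hL i.1 (sfE₄cov d mm ι a e hL μ₁ μ₂ i.1), fun i => foSiteSf d mm ι a e hL α β j j' i.1,
          fun i => foCovSf d mm ι a e hL α' β' j₂ j₂' i.1, fun _ _ => True, fun i => (sfInstance d mm ι hL i.1).gc.dist⟩ ∧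
      N15At { I := SfIdxGE d L w, c35 := c35, p := p, pi := fun i => sfInstance d mm ι hL i.1, Kop := fun i => sfFamily d mm ι a e hL i.1 (sfE₄cov d mm ι a e hL μ₁ μ₂ i.1),
              Ksite := fun i => foSiteSf d mm ι a e hL α β j j' i.1, Kunit := fun i => foCovSf d mm ι a e hL α' β' j₂ j₂' i.1,
              inΛ := fun _ _ => True, unitDist := fun i => (sfInstance d mm ι hL i.1).gc.dist } := by
  obtain ⟨w, hunit⟩ := ne2PlusUnit_foCovSf d mm ι a e hd hL hL7 ha hc35 he α' β' j₂ j₂'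
  exact ⟨w, live_sfGE d mm ι hL w hc35.le p _ _ _,
    ⟨ne2PlusOperator_comp (fun i : SfIdxGE d L w => i.1) (ne2PlusOperator_sf₄cov d mm ι e hL hL7 ha hc35 he μ₁ μ₂),
      ne2PlusSite_comp (fun i : SfIdxGE d L w => i.1) (ne2PlusSite_foSiteSf d mm ι a e hL hL7 ha hc35 he α β j j' 4 p), hunit⟩⟩

/-! ## §3 The road-(c) literal with ALL layers U-live (pinned threshold); keyed face -/

/-- **THE ROAD-(c) LITERAL WITH ALL THREE LAYERS U-LIVE** at a size threshold `w`: `NE2Objects₁₁` with n15-c's family restricted to `SfIdxGE d L w`, Σ-F's operator layer, (J-c)'s site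
kernel, (L-4)'s unit kernel. [bookkeeping] -/
def sfObjects₄covAll (hL : Odd L ∧ 1 < L) (μ₁ μ₂ α β : Fin (d + 1)) (j j' : ι) (α' β' : Fin (d + 1)) (j₂ j₂' : ι) (c35 p w : ℝ) : NE2Objects₁₁ :=
  ⟨SfIdxGE d L w, c35, p, fun i => sfInstance d mm ι hL i.1, fun i => sfFamily d mm ι a e hL i.1 (sfE₄cov d mm ι a e hL μ₁ μ₂ i.1), fun i => foSiteSf d mm ι a e hL α β j j' i.1,
    fun i => foCovSf d mm ι a e hL α' β' j₂ j₂' i.1, fun _ _ => True, fun i => (sfInstance d mm ι hL i.1).gc.dist⟩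

/-- the record map reads the literal as the rates bundle (`rfl`). [bookkeeping] -/
theorem ne2OfRecord₁₁_sfObjects₄covAll (hL : Odd L ∧ 1 < L) (μ₁ μ₂ α β : Fin (d + 1)) (j j' : ι) (α' β' : Fin (d + 1)) (j₂ j₂' : ι) (c35 p w : ℝ) :
    ne2OfRecord₁₁ (sfObjects₄covAll d mm ι a e hL μ₁ μ₂ α β j j' α' β' j₂ j₂' c35 p w) =
      { I := SfIdxGE d L w, c35 := c35, p := p, pi := fun i => sfInstance d mm ι hL i.1, Kop := fun i => sfFamily d mm ι a e hL i.1 (sfE₄cov d mm ι a e hL μ₁ μ₂ i.1),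
        Ksite := fun i => foSiteSf d mm ι a e hL α β j j' i.1, Kunit := fun i => foCovSf d mm ι a e hL α' β' j₂ j₂' i.1,
        inΛ := fun _ _ => True, unitDist := fun i => (sfInstance d mm ι hL i.1).gc.dist } := rfl

/-- ★★ there IS a threshold at which the all-live literal passes the guard and `N15At` (restatement of `live_and_n15At_sf₄cov_allLive` through the literal). [bookkeeping] -/
theorem exists_live_and_n15At_sfObjects₄covAll [Nonempty ι] (hd : 1 ≤ d) (hL : Odd L ∧ 1 < L) (hL7 : 7 ≤ L) (ha : 0 < a) {c35 : ℝ} (hc35 : 0 < c35)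
    (he : ∀ A B : Matrix mm mm ℂ, traceForm A B = e A ⬝ᵥ e B) (μ₁ μ₂ α β : Fin (d + 1)) (j j' : ι) (α' β' : Fin (d + 1)) (j₂ j₂' : ι) (p : ℝ) :
    ∃ w : ℝ, Live (ne2OfRecord₁₁ (sfObjects₄covAll d mm ι a e hL μ₁ μ₂ α β j j' α' β' j₂ j₂' c35 p w)) ∧
      N15At (ne2OfRecord₁₁ (sfObjects₄covAll d mm ι a e hL μ₁ μ₂ α β j j' α' β' j₂ j₂' c35 p w)) :=
  live_and_n15At_sf₄cov_allLive d mm ι a e hd hL hL7 ha hc35 he μ₁ μ₂ α β j j' α' β' j₂ j₂' p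

/-- **THE PINNED THRESHOLD** `w_all` (a choice of the threshold of `exists_live_and_n15At_sfObjects₄covAll`; depends on `(d, L, mm, ι, a, e, c₃₅, directions, colours, p)` through the
hypotheses it is chosen under). [bookkeeping] -/
def wAll [Nonempty ι] (hd : 1 ≤ d) (hL : Odd L ∧ 1 < L) (hL7 : 7 ≤ L) (ha : 0 < a) {c35 : ℝ} (hc35 : 0 < c35) (he : ∀ A B : Matrix mm mm ℂ, traceForm A B = e A ⬝ᵥ e B)
    (μ₁ μ₂ α β : Fin (d + 1)) (j j' : ι) (α' β' : Fin (d + 1)) (j₂ j₂' : ι) (p : ℝ) : ℝ :=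
  Classical.choose (exists_live_and_n15At_sfObjects₄covAll d mm ι a e hd hL hL7 ha hc35 he μ₁ μ₂ α β j j' α' β' j₂ j₂' p)

/-- ★★★ **GUARD ∧ `N15At` AT THE ALL-LIVE LITERAL PINNED AT `w_all`** (`d ≥ 1`, odd `L ≥ 7`, `a, c₃₅ > 0`, trace-form-orthonormal `e`, `ι` nonempty) — a CLOSED literal for a road-(c)
re-pin with NO U-blind layer. [bookkeeping] -/
theorem live_and_n15At_sfObjects₄covAll_wAll [Nonempty ι] (hd : 1 ≤ d) (hL : Odd L ∧ 1 < L) (hL7 : 7 ≤ L) (ha : 0 < a) {c35 : ℝ} (hc35 : 0 < c35)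
    (he : ∀ A B : Matrix mm mm ℂ, traceForm A B = e A ⬝ᵥ e B) (μ₁ μ₂ α β : Fin (d + 1)) (j j' : ι) (α' β' : Fin (d + 1)) (j₂ j₂' : ι) (p : ℝ) :
    Live (ne2OfRecord₁₁ (sfObjects₄covAll d mm ι a e hL μ₁ μ₂ α β j j' α' β' j₂ j₂' c35 p (wAll d mm ι a e hd hL hL7 ha hc35 he μ₁ μ₂ α β j j' α' β' j₂ j₂' p))) ∧
      N15At (ne2OfRecord₁₁ (sfObjects₄covAll d mm ι a e hL μ₁ μ₂ α β j j' α' β' j₂ j₂' c35 p (wAll d mm ι a e hd hL hL7 ha hc35 he μ₁ μ₂ α β j j' α' β' j₂ j₂' p))) :=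
  Classical.choose_spec (exists_live_and_n15At_sfObjects₄covAll d mm ι a e hd hL hL7 ha hc35 he μ₁ μ₂ α β j j' α' β' j₂ j₂' p)

variable {N : ℕ} [NeZero N] {key : (F : T4Family) → Datum F N → Prop}

/-- ★★ **THE ALL-LIVE LITERAL AT ANY KEYED HOME** (part 30's interface): a rate home over ANY key admitting only the literals of a key-indexed NE2 reading whose value everywhere is the
pinned all-live literal has `S_N15 RRec` (`d ≥ 1`, odd `L ≥ 7`, `a, c₃₅ > 0`, trace-form-orthonormal `e`, `ι` nonempty). [bookkeeping] -/
theorem s_N15_of_admits_sf₄covAll [Nonempty ι] (hd : 1 ≤ d) (hL : Odd L ∧ 1 < L) (hL7 : 7 ≤ L) (ha : 0 < a) {c35 : ℝ} (hc35 : 0 < c35)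
    (he : ∀ A B : Matrix mm mm ℂ, traceForm A B = e A ⬝ᵥ e B) (μ₁ μ₂ α β : Fin (d + 1)) (j j' : ι) (α' β' : Fin (d + 1)) (j₂ j₂' : ι) (p : ℝ)
    (ne2At : ∀ {F : T4Family} {D : Datum F N}, key F D → (ℕ → ℝ) → List (ULoop F) → ℕ → NE2Objects₁₁) (RRec : RateRecordPred N)
    (hadm : ∀ (F : T4Family) (D : Datum F N) (g₀ : ℕ → ℝ) (os : List (ULoop F)) (R : RateCarriers N), RRec F D g₀ os R →
      ∃ (h : key F D) (k : ℕ), R.ne2 = ne2OfRecord₁₁ (ne2At h g₀ os k))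
    (h : ∀ (F : T4Family) (D : Datum F N) (h : key F D) (g₀ : ℕ → ℝ) (os : List (ULoop F)) (k : ℕ),
      ne2At h g₀ os k = sfObjects₄covAll d mm ι a e hL μ₁ μ₂ α β j j' α' β' j₂ j₂' c35 p (wAll d mm ι a e hd hL hL7 ha hc35 he μ₁ μ₂ α β j j' α' β' j₂ j₂' p)) :
    S_N15 RRec :=
  s_N15_of_admits ne2At RRec hadm fun F D hk g₀ os k => by
    rw [h F D hk g₀ os k]; exact (live_and_n15At_sfObjects₄covAll_wAll d mm ι a e hd hL hL7 ha hc35 he μ₁ μ₂ α β j j' α' β' j₂ j₂' p).2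

end Knit

end Summit.QuantumFields.YangMills.BalabanUVNodes.N15.SiteLayerSf

end
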